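import Literature.Probability.LatticeModels.DiluteLoopModel
import Literature.Probability.LatticeModels.ModifiedSimonInequality
import HarnessLib

/-!
# The `n = 1`, `w = ½` dilute loop model is the Ising high-temperature expansion

Topic `Literature/Probability/LatticeModels`; companion of `DiluteLoopModel.lean` (definition item
`defn-DiluteLoopModel`, sanity identity (i) requested with it): the `n = 1` ANCHOR of route
`CriticalPhenomena/SAWScalingLimit/SAWLoopFugacityFlow`.

At loop fugacity `n = 1` and collision weight `w = ½` the `2^{N(F)}` non-crossing resolutions of an
edge set `F` weigh `2^{-N(F)}` each (`DiluteLoopModel.sum_weight_one_half`), so the partition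
function with source set `A` is the high-temperature generating sum
`hteSum G Λ x A = Σ_{F ⊆ ℰ_Λ, ∂F = A} x^{|F|}` of `ModifiedSimonInequality.lean`
(`partitionFunction_one_half_eq_hteSum`), and by the high-temperature expansion proved there
(`isingTwoPoint_free_eq_hteSum_div`, Duminil-Copin, ECM 2016, §2.2.1) the normalised two-leg
function at `x = tanh β` is the free-boundary Ising two-point function
(`twoLeg_one_half_tanh_eq_isingTwoPoint`). On discretised domains at `β = β_c(2)`
(`tanh β_c(2) = √2 - 1`, `tanh_criticalBetaTwo`) the route's boundary ratio `R_δ(1; Ω, Ω')` is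
literally the ratio of free critical Ising two-point functions of item IsingBoundaryRatio
(`domainBoundaryRatio_isingPoint`).

## References

* H. Duminil-Copin, *Random currents expansion of the Ising model*, ECM 2016, §2.2.1.
  [DuminilCopinECM2018]
* W. Guo, H. W. J. Blöte, B. Nienhuis, Int. J. Mod. Phys. C 10 (1999) 301, §2 (`Z'/Z`).
  [GuoBloteNienhuis1999]
* S. Friedli, Y. Velenik, *Statistical Mechanics of Lattice Systems* (2017), §3.10.1 (`β_c(2)`).
  [FriedliVelenik2017]
-/

noncomputable section

open Finset
open scoped symmDiff

namespace Literature.Probability.LatticeModels.DiluteLoopModel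

variable {G : SimpleGraph (Site 2)} [G.LocallyFinite]

/-- The admissible edge sets of the loop model are the index set of `hteSum`: `F ⊆ ℰ_Λ` with
`oddVerts Λ F = A`. [cite: DuminilCopinECM2018, §2.2.1 (high-temperature expansion)] -/
theorem configs_eq_filter_oddVerts (Λ A : Finset (Site 2)) :
    configs G Λ A = (edgesIn G Λ).powerset.filter fun F => oddVerts Λ F = A := rfl

/-- **`Z_{1,½,x}(G, Λ; A) = hteSum G Λ x A`**: the `n = 1`, `w = ½` dilute loop model is the
high-temperature graph expansion with edge weight `x`. [cite: DuminilCopinECM2018, §2.2.1 (high-temperature expansion)] -/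
theorem partitionFunction_one_half_eq_hteSum (x : ℝ) (Λ A : Finset (Site 2)) :
    (⟨1, 2⁻¹, x⟩ : DiluteLoopModel ℝ).partitionFunction G Λ A = hteSum G Λ x A := by
  rw [partitionFunction_one_half]
  rfl

/-- **The `n = 1` anchor: `twoLeg ⟨1, ½, tanh β⟩ G Λ a b = ⟨σ_a σ_b⟩^free_{Λ;β,0}`** for `a, b ∈ Λ`
(high-temperature expansion of the free-boundary Ising two-point function). [cite: DuminilCopinECM2018, §2.2.1 (high-temperature expansion)] -/
theorem twoLeg_one_half_tanh_eq_isingTwoPoint (β : ℝ) {Λ : Finset (Site 2)} {a b : Site 2}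
    (ha : a ∈ Λ) (hb : b ∈ Λ) :
    (⟨1, 2⁻¹, Real.tanh β⟩ : DiluteLoopModel ℝ).twoLeg G Λ a b = isingTwoPoint G Λ β 0 .free a b := by
  rw [twoLeg, partitionFunction_one_half_eq_hteSum, partitionFunction_one_half_eq_hteSum,
    isingTwoPoint_free_eq_hteSum_div G Λ β ha hb]

/-- The same on a discretised domain `Ω_δ`: for lattice points `a, b` of `Ω_δ`,
`domainTwoLeg ⟨1, ½, tanh β⟩ Ω δ a b` is the free-boundary Ising two-point function of
`discreteDomainGraph Ω δ` in the volume `meshDomainFinset Ω δ`. [cite: DuminilCopinECM2018, §2.2.1 (high-temperature expansion)] -/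
theorem domainTwoLeg_one_half_tanh_eq_isingTwoPoint (β : ℝ) {Ω : Set ℂ} {δ : ℝ} {a b : Site 2}
    (ha : a ∈ meshDomainFinset Ω δ) (hb : b ∈ meshDomainFinset Ω δ) :
    (⟨1, 2⁻¹, Real.tanh β⟩ : DiluteLoopModel ℝ).domainTwoLeg Ω δ a b =
      isingTwoPoint (discreteDomainGraph Ω δ) (meshDomainFinset Ω δ) β 0 .free a b :=
  twoLeg_one_half_tanh_eq_isingTwoPoint β ha hb

/-- `tanh β_c(2) = √2 - 1`: the critical edge fugacity of the `n = 1`, `w = ½` model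
(`β_c(2) = ½ log (1 + √2)`, so `e^{2β_c} = 1 + √2`). [cite: FriedliVelenik2017, §3.10.1] -/
theorem tanh_criticalBetaTwo : Real.tanh criticalBetaTwo = Real.sqrt 2 - 1 := by
  have h2 : Real.exp (2 * criticalBetaTwo) = 1 + Real.sqrt 2 := by
    rw [criticalBetaTwo, mul_div_cancel₀ _ two_ne_zero, Real.exp_log (by positivity)]
  have he : 0 < Real.exp criticalBetaTwo := Real.exp_pos _
  have hs : Real.sqrt 2 ^ 2 = 2 := Real.sq_sqrt (by norm_num)
  have hsq : Real.exp criticalBetaTwo ^ 2 = 1 + Real.sqrt 2 := by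
    rw [← h2, ← Real.exp_nat_mul]; norm_num
  rw [Real.tanh_eq_sinh_div_cosh, Real.sinh_eq, Real.cosh_eq, Real.exp_neg]
  have hpos : 0 < Real.sqrt 2 := by positivity
  field_simp
  nlinarith [hsq, hs, he, hpos]

/-- **The route's boundary ratio at the Ising point is the ratio of free critical Ising two-point
functions**: for `a, b` lattice points of both `Ω'_δ` and `Ω_δ`,
`domainBoundaryRatio ⟨1, ½, tanh β_c(2)⟩ Ω' Ω δ a b
  = ⟨σ_a σ_b⟩^free_{Ω'_δ; β_c} / ⟨σ_a σ_b⟩^free_{Ω_δ; β_c}` — the quantity of item IsingBoundaryRatio of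
route SAWLoopFugacityFlow. [cite: DuminilCopinECM2018, §2.2.1 (high-temperature expansion)] -/
theorem domainBoundaryRatio_isingPoint {Ω' Ω : Set ℂ} {δ : ℝ} {a b : Site 2}
    (ha' : a ∈ meshDomainFinset Ω' δ) (hb' : b ∈ meshDomainFinset Ω' δ)
    (ha : a ∈ meshDomainFinset Ω δ) (hb : b ∈ meshDomainFinset Ω δ) :
    (⟨1, 2⁻¹, Real.tanh criticalBetaTwo⟩ : DiluteLoopModel ℝ).domainBoundaryRatio Ω' Ω δ a b =
      isingTwoPoint (discreteDomainGraph Ω' δ) (meshDomainFinset Ω' δ) criticalBetaTwo 0 .free a b /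
        isingTwoPoint (discreteDomainGraph Ω δ) (meshDomainFinset Ω δ) criticalBetaTwo 0 .free a b := by
  rw [domainBoundaryRatio, domainTwoLeg_one_half_tanh_eq_isingTwoPoint _ ha' hb',
    domainTwoLeg_one_half_tanh_eq_isingTwoPoint _ ha hb]

/-- The source-free `n = 1`, `w = ½` partition function at `x = tanh β` is positive (it carries the
Ising partition function), so `twoLeg` and the boundary ratio are honest quotients there. [cite: DuminilCopinECM2018, §2.2.1 (high-temperature expansion)] -/
theorem partitionFunction_one_half_tanh_pos (β : ℝ) (Λ : Finset (Site 2)) :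
    0 < (⟨1, 2⁻¹, Real.tanh β⟩ : DiluteLoopModel ℝ).partitionFunction G Λ ∅ := by
  rw [partitionFunction_one_half_eq_hteSum]
  exact hteSum_empty_pos G Λ β

end Literature.Probability.LatticeModels.DiluteLoopModel
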